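import Mathlib
import Literature.NumberTheory.LFunctions.Zhang2022.TypedSection17
import Literature.NumberTheory.LFunctions.Zhang2022.Section5Lemma51
import Literature.NumberTheory.LFunctions.Zhang2022.Section13U007bTools
import Literature.NumberTheory.LFunctions.Zhang2022.Section2FunctionalEquation
import Literature.NumberTheory.LFunctions.Zhang2022.SkeletonWindowPowers
import HarnessLib

/-!
# Zhang (2022), §17 p. 97: the Lemma-5.1 reflection step `Z22:§17.u010`, and Lemma 5.1 in RELATIVE
# form (`Z(s+ib,ψ) = Z(s,ψ)(pt₀)^{−ib}(1 + O_K(𝓛⁻¹²³))`, `|b| ≤ Kα`), kernel-checked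

Topic `Literature/NumberTheory/LFunctions/Zhang2022` (Landau–Siegel audit tree; verdict-neutral).
Y. Zhang, *Discrete mean estimates and the Landau–Siegel zero*, arXiv:2211.02515v1 (2022)
[Zhang2022LandauSiegel] — **an unrefereed manuscript under adjudication; nothing here asserts or denies
its Theorems 1–2.** Lane ZHANG-L (discharge of the typed §17 nodes feeding the leaf
`Typed.Section17.Eq17_9Rel` through (17.7)).

§17 p. 97 (tex L4770–L4774), in the treatment of the `I₄⁻(ψ)`-sum:

> To treat the sum involving `I₄⁻(ψ)` on `𝔍(−α)` we first apply Lemma 5.1 to obtain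
> `L(s+β₁,ψ)/L(s,ψ) = (pt₀)^{−β₁} · L(1−s−β₁,ψ̄)/L(1−s,ψ̄) · (1 + O(α⁶))`
> for `ψ ∈ Ψ₁` and `s ∈ 𝔍(−α)`.

What is here (theorem-only; 0 new definitions, 0 named facts):

* `Skeleton.exists_Zfac_shift_rel` — **Lemma 5.1 (first assertion) in relative form**: for every
  `K ≥ 0` there are `A ≥ 0` and `D₀` with: for `D ≥ D₀`, `ψ ∈ Ψ`, `|Re s − ½| ≤ α`,
  `|Im s − 2πt₀| < 𝓛₁ + 2` and every real `b` with `|b| ≤ Kα`,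
  `Z(s+ib,ψ) = Z(s,ψ)·(pt₀)^{−ib}·(1 + ε)` with `|ε| ≤ A·𝓛⁻¹²³` — from the landed Lemma 5.1
  (`Skeleton.lemma51_holds`: `‖Z(s+iv,ψ) − Z(s,ψ)(pt₀)^{−iv}‖ ≤ C𝓛⁻¹¹⁴|v|` for `0 < |v| < 𝓛²⁰`),
  `|Z(s,ψ)|⁻¹ ≤ e¹⁶` near the critical line (`Typed.Section13.norm_inv_Zfac_le_exp_sixteen`),
  `|(pt₀)^{−ib}| = 1`, and `α = π𝓛⁻⁹` (so `C𝓛⁻¹¹⁴·Kα·e¹⁶ = (e¹⁶CKπ)𝓛⁻¹²³`);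
* `Skeleton.LFunction_shift_eq_rel` — the same combined with the functional equation (2.2) of the tree
  (`GammaFactor.LFunction_eq_Zfac_mul`): `L(s+ib,ψ) = Z(s,ψ)(pt₀)^{−ib}(1 + ε)·L(1−s−ib,ψ̄)`;
* `Typed.Section17.step17_u010_holds` — **`Z22:§17.u010` BY NAME**, for every real `c′` (constant and
  threshold depending on `c′`): with `β₁ = ib₁`, `|b₁| ≤ 2(1+5|c′|)α`, the two displays above and
  `L(s,ψ) = Z(s,ψ)L(1−s,ψ̄)` give `L(s+β₁,ψ)/L(s,ψ) = M(1 + ε)`, `M = (pt₀)^{−β₁}L(1−s−β₁,ψ̄)/L(1−s,ψ̄)`,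
  and `A𝓛⁻¹²³ ≤ (A/π⁶)α⁶` since `α⁶ = π⁶𝓛⁻⁵⁴`. (The hypotheses `(A)` and `ψ ∈ Ψ₁` of the typed node
  are not used.)

The §15 twin `Z22:§15.u004` (two shifts, the factor `Z(s,ψ)` kept) is `Typed.Section15A.step15_u004_holds`
(`Section15GammaFactorSteps`). Nothing about (17.7)–(17.10), Theorems 1–2 or Landau–Siegel zeros is
asserted here.

## References

* Y. Zhang, arXiv:2211.02515v1 (2022), §17 p. 97 (tex L4770); §5 Lemma 5.1 p. 24; §2 (2.2) p. 4.
  [cite: Zhang2022LandauSiegel, §17 p. 97; §5 Lemma 5.1; §2 (2.2)]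
* H. L. Montgomery, R. C. Vaughan, *Multiplicative Number Theory I* (CUP 2007), Cor 10.9 (asymmetric
  functional equation). [cite: MontgomeryVaughan2007, Cor 10.9]
-/

noncomputable section

open Complex Real ComplexConjugate

namespace Literature.NumberTheory.LFunctions.Zhang2022

namespace Skeleton

/-- `L₀ ≤ log D` once `D ≥ ⌈exp L₀⌉₊`. [folklore] -/
private theorem le_ell_of_ceil_exp_le_u010 {L₀ : ℝ} {D : ℕ} (hD : ⌈Real.exp L₀⌉₊ ≤ D) :
    L₀ ≤ ell D := by
  have h : Real.exp L₀ ≤ D := le_trans (Nat.le_ceil _) (by exact_mod_cast hD)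
  exact (Real.le_log_iff_exp_le (lt_of_lt_of_le (Real.exp_pos _) h)).mpr h

/-- `|(pt₀)^{−ib}| = 1` for `p ∼ P` (`pt₀ > 0`, purely imaginary exponent; `𝓛 > 0`) — the size of
the factor `(pt₀)^{−w}`, `w = iv`, of Lemma 5.1 (5.1). [cite: Zhang2022LandauSiegel, §5 Lemma 5.1 (5.1) p. 24] -/
theorem norm_pt0_cpow_neg_mul_I {D : ℕ} (x : Chr D) (hL : 0 < ell D) (b : ℝ) :
    ‖(((x.p : ℝ) * t0 D : ℝ) : ℂ) ^ (-((b : ℂ) * I))‖ = 1 := by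
  have hpt : 0 < (x.p : ℝ) * t0 D := by
    have hp : (0 : ℝ) < x.p := by exact_mod_cast x.prime.pos
    have ht : 0 < t0 D := by rw [show t0 D = ell D ^ 519 from rfl]; positivity
    exact mul_pos hp ht
  rw [Complex.norm_cpow_eq_rpow_re_of_pos hpt]
  simp

/-- **Lemma 5.1 (first assertion) in RELATIVE form.** For every `K ≥ 0` there are `A ≥ 0` and `D₀`
such that for all `D ≥ D₀`, every `ψ ∈ Ψ`, every `s` with `|Re s − ½| ≤ α`, `|Im s − 2πt₀| < 𝓛₁ + 2`,
and every real `b` with `|b| ≤ Kα`: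
`Z(s+ib,ψ) = Z(s,ψ)·(pt₀)^{−ib}·(1 + ε)` with `|ε| ≤ A𝓛⁻¹²³`
(Lemma 5.1 as landed, `|Z(s,ψ)|⁻¹ ≤ e¹⁶`, `|(pt₀)^{−ib}| = 1`, `α = π𝓛⁻⁹`).
[cite: Zhang2022LandauSiegel, §5 Lemma 5.1 p. 24; §17 p. 97] -/
theorem exists_Zfac_shift_rel {K : ℝ} (hK : 0 ≤ K) :
    ∃ A : ℝ, 0 ≤ A ∧ ForAllLarge fun D _ _ => ∀ x : Chr D, ∀ s : ℂ, InRange51 D s →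
      ∀ b : ℝ, |b| ≤ K * alpha D →
        ∃ ε : ℂ, GammaFactor.Zfac x.ψ (s + b * I) =
            GammaFactor.Zfac x.ψ s * (((x.p : ℝ) * t0 D : ℝ) : ℂ) ^ (-((b : ℂ) * I)) * (1 + ε) ∧
          ‖ε‖ ≤ A * (ell D ^ 123)⁻¹ := by
  obtain ⟨C, D₅₁, h51⟩ := lemma51_holds
  set C₀ : ℝ := max C 0 with hC₀
  set A : ℝ := Real.exp 16 * C₀ * K * π with hA
  have hC₀0 : 0 ≤ C₀ := le_max_right _ _
  have hCC₀ : C ≤ C₀ := le_max_left _ _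
  refine ⟨A, by positivity,
    ForAllLarge.of_le (max D₅₁ ⌈Real.exp (K * π + 4)⌉₊) fun D _ χ hD hq hχ x s hs b hb => ?_⟩
  -- sizes of the parameters
  have hD₅₁ : D₅₁ ≤ D := le_trans (le_max_left _ _) hD
  have hLK : K * π + 4 ≤ ell D := le_ell_of_ceil_exp_le_u010 (le_trans (le_max_right _ _) hD)
  have hKπ : 0 ≤ K * π := by positivity
  have hL3 : 3 ≤ ell D := by linarith
  have hL1 : 1 ≤ ell D := by linarith
  have hL0 : 0 < ell D := by linarith
  have hα : 0 < alpha D := alpha_pos' hL0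
  have hαeq : alpha D = π / ell D ^ 9 := by rw [alpha, bigP, Real.log_exp]
  have hαπ : alpha D ≤ π := by
    rw [hαeq]
    exact div_le_self Real.pi_pos.le (one_le_pow₀ hL1)
  have hKα : K * alpha D < ell D := by
    calc K * alpha D ≤ K * π := mul_le_mul_of_nonneg_left hαπ hK
      _ < ell D := by linarith
  -- the range: `|Re s − ½| ≤ α`, `Im s ≥ 3𝓛⁵¹⁹`
  obtain ⟨hre, himJ⟩ := hs
  have him3 : 3 * ell D ^ 519 ≤ s.im := by
    have ht0 : t0 D = ell D ^ 519 := rfl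
    have hell1 : ell1 D = ell D ^ 405 := rfl
    have h405 : ell D ^ 405 ≤ ell D ^ 519 := pow_le_pow_right₀ hL1 (by norm_num)
    have h519' : (1 : ℝ) ≤ ell D ^ 519 := one_le_pow₀ hL1
    have hπ519 : 3 * ell D ^ 519 ≤ π * ell D ^ 519 :=
      mul_le_mul_of_nonneg_right Real.pi_gt_three.le (by linarith)
    have h1 := (abs_lt.mp himJ).1
    rw [hell1, ht0] at h1
    linarith
  have h519 : ell D ≤ ell D ^ 519 := le_self_pow₀ hL1 (by norm_num)
  have hspos : 0 < s.im := by linarith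
  set base : ℂ := (((x.p : ℝ) * t0 D : ℝ) : ℂ) with hbase
  set Z : ℂ := GammaFactor.Zfac x.ψ s with hZ
  set u : ℂ := base ^ (-((b : ℂ) * I)) with hu
  -- Lemma 5.1: `‖Z(s+ib) − Z(s)(pt₀)^{−ib}‖ ≤ C₀𝓛⁻¹¹⁴|b|`
  have hshift : ‖GammaFactor.Zfac x.ψ (s + b * I) - Z * u‖ ≤ C₀ * (ell D ^ 114)⁻¹ * |b| := by
    rcases eq_or_ne b 0 with hb0 | hb0
    · simp [hZ, hu, hb0]
    · have hb20 : |b| < ell D ^ 20 := by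
        calc |b| ≤ K * alpha D := hb
          _ < ell D := hKα
          _ ≤ ell D ^ 20 := le_self_pow₀ hL1 (by norm_num)
      have h := (h51 D χ hD₅₁ hq hχ x s ⟨hre, himJ⟩ b hb0 hb20).1
      have hbIn : ‖(b : ℂ) * I‖ = |b| := by
        rw [norm_mul, Complex.norm_I, mul_one, Complex.norm_real, Real.norm_eq_abs]
      rw [norm_div, hbIn, div_le_iff₀ (abs_pos.mpr hb0)] at h
      calc ‖GammaFactor.Zfac x.ψ (s + b * I) - Z * u‖
          ≤ C * (ell D ^ 114)⁻¹ * |b| := h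
        _ ≤ C₀ * (ell D ^ 114)⁻¹ * |b| := by gcongr
  -- `Z(s,ψ) ≠ 0`, `|Z(s,ψ)|⁻¹ ≤ e¹⁶`, `|(pt₀)^{−ib}| = 1`
  have hZne : Z ≠ 0 := GammaFactor.Zfac_ne_zero x.prim hspos
  have hZinv : ‖Z⁻¹‖ ≤ Real.exp 16 := by
    have hσ : |s.re - 1 / 2| ≤ 2 * alpha D := by linarith
    have ht : |s.im - 2 * π * ell D ^ 519| < ell D ^ 405 + 2 := himJ
    have h := Typed.Section13.norm_inv_Zfac_le_exp_sixteen x hL3 hσ ht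
    rwa [Complex.re_add_im] at h
  have hu1 : ‖u‖ = 1 := norm_pt0_cpow_neg_mul_I x hL0 b
  have hune : u ≠ 0 := fun h => by rw [h, norm_zero] at hu1; exact zero_ne_one hu1
  have hZu : Z * u ≠ 0 := mul_ne_zero hZne hune
  refine ⟨(GammaFactor.Zfac x.ψ (s + b * I) - Z * u) / (Z * u), ?_, ?_⟩
  · rw [mul_add, mul_one, mul_div_assoc', mul_div_cancel_left₀ _ hZu]
    ring
  · rw [norm_div, norm_mul, hu1, mul_one, div_eq_mul_inv, ← norm_inv]
    calc ‖GammaFactor.Zfac x.ψ (s + b * I) - Z * u‖ * ‖Z⁻¹‖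
        ≤ (C₀ * (ell D ^ 114)⁻¹ * |b|) * Real.exp 16 :=
          mul_le_mul hshift hZinv (norm_nonneg _) (by positivity)
      _ ≤ (C₀ * (ell D ^ 114)⁻¹ * (K * alpha D)) * Real.exp 16 := by gcongr
      _ = A * (ell D ^ 123)⁻¹ := by
          rw [hA, hαeq]
          field_simp

/-- **Lemma 5.1 in relative form through the functional equation (2.2)**: for every `K ≥ 0` there
are `A ≥ 0` and `D₀` with, for `D ≥ D₀`, `ψ ∈ Ψ`, `|Re s − ½| ≤ α`, `|Im s − 2πt₀| < 𝓛₁ + 2`,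
`|b| ≤ Kα`: `L(s+ib,ψ) = Z(s,ψ)(pt₀)^{−ib}(1 + ε)·L(1−s−ib,ψ̄)`, `|ε| ≤ A𝓛⁻¹²³` (`ψ̄ = ψ⁻¹`; the
tree's `GammaFactor.LFunction_eq_Zfac_mul` at `s + ib`, where `Im(s+ib) > 0`).
[cite: Zhang2022LandauSiegel, §2 (2.2); §5 Lemma 5.1; §17 p. 97] -/
theorem LFunction_shift_eq_rel {K : ℝ} (hK : 0 ≤ K) :
    ∃ A : ℝ, 0 ≤ A ∧ ForAllLarge fun D _ _ => ∀ x : Chr D, ∀ s : ℂ, InRange51 D s →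
      ∀ b : ℝ, |b| ≤ K * alpha D →
        ∃ ε : ℂ, x.ψ.LFunction (s + b * I) =
            GammaFactor.Zfac x.ψ s * (((x.p : ℝ) * t0 D : ℝ) : ℂ) ^ (-((b : ℂ) * I)) * (1 + ε) *
              x.ψ⁻¹.LFunction (1 - s - b * I) ∧
          ‖ε‖ ≤ A * (ell D ^ 123)⁻¹ := by
  obtain ⟨A, hA0, D₁, h⟩ := exists_Zfac_shift_rel hK
  refine ⟨A, hA0, ForAllLarge.of_le (max D₁ ⌈Real.exp (K * π + 4)⌉₊)
    fun D _ χ hD hq hχ x s hs b hb => ?_⟩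
  have hD₁ : D₁ ≤ D := le_trans (le_max_left _ _) hD
  have hLK : K * π + 4 ≤ ell D := le_ell_of_ceil_exp_le_u010 (le_trans (le_max_right _ _) hD)
  have hKπ : 0 ≤ K * π := by positivity
  have hL1 : 1 ≤ ell D := by linarith
  have hL0 : 0 < ell D := by linarith
  have hα : 0 < alpha D := alpha_pos' hL0
  have hαeq : alpha D = π / ell D ^ 9 := by rw [alpha, bigP, Real.log_exp]
  have hαπ : alpha D ≤ π := by
    rw [hαeq]
    exact div_le_self Real.pi_pos.le (one_le_pow₀ hL1)
  have hKα : K * alpha D < ell D := by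
    calc K * alpha D ≤ K * π := mul_le_mul_of_nonneg_left hαπ hK
      _ < ell D := by linarith
  have him3 : 3 * ell D ^ 519 ≤ s.im := by
    have ht0 : t0 D = ell D ^ 519 := rfl
    have hell1 : ell1 D = ell D ^ 405 := rfl
    have h405 : ell D ^ 405 ≤ ell D ^ 519 := pow_le_pow_right₀ hL1 (by norm_num)
    have h519' : (1 : ℝ) ≤ ell D ^ 519 := one_le_pow₀ hL1
    have hπ519 : 3 * ell D ^ 519 ≤ π * ell D ^ 519 :=
      mul_le_mul_of_nonneg_right Real.pi_gt_three.le (by linarith)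
    have h1 := (abs_lt.mp hs.2).1
    rw [hell1, ht0] at h1
    linarith
  have h519 : ell D ≤ ell D ^ 519 := le_self_pow₀ hL1 (by norm_num)
  have himb : (s + b * I).im ≠ 0 := by
    have e : (s + b * I).im = s.im + b := by simp
    rw [e]
    have hb' := (abs_le.mp hb).1
    exact ne_of_gt (by linarith)
  obtain ⟨ε, hZb, hε⟩ := h D χ hD₁ hq hχ x s hs b hb
  refine ⟨ε, ?_, hε⟩
  rw [GammaFactor.LFunction_eq_Zfac_mul x.prim x.p_ne_one himb, hZb,
    show (1 : ℂ) - (s + b * I) = 1 - s - b * I by ring]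

end Skeleton

namespace Typed.Section17

open Literature.NumberTheory.LFunctions.Zhang2022.Skeleton

/-- `L₀ ≤ log D` once `D ≥ ⌈exp L₀⌉₊`. [folklore] -/
private theorem le_ell_of_ceil_exp_le_s17 {L₀ : ℝ} {D : ℕ} (hD : ⌈Real.exp L₀⌉₊ ≤ D) :
    L₀ ≤ ell D := by
  have h : Real.exp L₀ ≤ D := le_trans (Nat.le_ceil _) (by exact_mod_cast hD)
  exact (Real.le_log_iff_exp_le (lt_of_lt_of_le (Real.exp_pos _) h)).mpr h

/-- **`Z22:§17.u010` DISCHARGED** (§17 p. 97, tex L4770): for every real `c′` there are `C` and `D₀`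
with, for `D ≥ D₀`, `ψ ∈ Ψ` (a fortiori `ψ ∈ Ψ₁`, under (A) or not) and `s ∈ 𝔍(−α)`
(`Re s = ½ − α`, `|Im s − 2πt₀| ≤ 𝓛₁`), writing `M = (pt₀)^{−β₁}L(1−s−β₁,ψ̄)/L(1−s,ψ̄)`:
`‖L(s+β₁,ψ)/L(s,ψ) − M‖ ≤ C·α⁶·‖M‖` — the printed "apply Lemma 5.1 to obtain
`L(s+β₁,ψ)/L(s,ψ) = (pt₀)^{−β₁}(L(1−s−β₁,ψ̄)/L(1−s,ψ̄))(1 + O(α⁶))`". From `LFunction_shift_eq_rel`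
at `b = b₁` (`β₁ = ib₁`, `|b₁| ≤ 2(1+5|c′|)α`), `L(s,ψ) = Z(s,ψ)L(1−s,ψ̄)` ((2.2)), `Z(s,ψ) ≠ 0`, and
`𝓛⁻¹²³ ≤ 𝓛⁻⁵⁴ = α⁶/π⁶`. [cite: Zhang2022LandauSiegel, §17 p. 97] -/
theorem step17_u010_holds (c' : ℝ) : Step17_u010 c' := by
  set K : ℝ := 2 * (1 + 5 * |c'|) with hK
  have hK0 : 0 ≤ K := by rw [hK]; positivity
  obtain ⟨A, hA0, D₁, h⟩ := LFunction_shift_eq_rel hK0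
  refine ⟨A / π ^ 6, ForAllLarge.of_le (max D₁ ⌈Real.exp (K * π + 4)⌉₊)
    fun D _ χ hD hq hχ _ x _ s hre him => ?_⟩
  intro M
  have hM : M = (((x.p : ℝ) * t0 D : ℝ) : ℂ) ^ (-beta1 c' D) *
      (x.ψ⁻¹.LFunction (1 - s - beta1 c' D) / x.ψ⁻¹.LFunction (1 - s)) := rfl
  -- sizes of the parameters
  have hD₁ : D₁ ≤ D := le_trans (le_max_left _ _) hD
  have hLK : K * π + 4 ≤ ell D := le_ell_of_ceil_exp_le_s17 (le_trans (le_max_right _ _) hD)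
  have hKπ : 0 ≤ K * π := by positivity
  have hL2 : 2 ≤ ell D := by linarith
  have hL1 : 1 ≤ ell D := by linarith
  have hL0 : 0 < ell D := by linarith
  have hα : 0 < alpha D := alpha_pos' hL0
  have hαeq : alpha D = π / ell D ^ 9 := by rw [alpha, bigP, Real.log_exp]
  have hαℓ : alpha D * ell D ≤ 1 := alpha_mul_ell_le_one hL2
  -- the segment `𝔍(−α)` lies in Lemma 5.1's range; `Im s > 0`
  have hR51 : InRange51 D s := by
    refine ⟨?_, ?_⟩
    · rw [hre, show 1 / 2 - alpha D - 1 / 2 = -alpha D by ring, abs_neg, abs_of_pos hα]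
    · have : ell1 D < ell1 D + 2 := by linarith
      exact lt_of_le_of_lt him this
  have hspos : 0 < s.im := by
    have ht0 : t0 D = ell D ^ 519 := rfl
    have hell1 : ell1 D = ell D ^ 405 := rfl
    have h405 : ell D ^ 405 ≤ ell D ^ 519 := pow_le_pow_right₀ hL1 (by norm_num)
    have h519' : (1 : ℝ) ≤ ell D ^ 519 := one_le_pow₀ hL1
    have hπ519 : 3 * ell D ^ 519 ≤ π * ell D ^ 519 :=
      mul_le_mul_of_nonneg_right Real.pi_gt_three.le (by linarith)
    have h1 := (abs_le.mp him).1
    rw [hell1, ht0] at h1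
    linarith
  -- `β₁ = ib₁`, `|b₁| ≤ Kα`
  set b₁ : ℝ := alpha D * (1 - 5 * c' * alpha D * ell D) with hb₁
  have hβ₁ : beta1 c' D = (b₁ : ℂ) * I := by simp only [beta1, hb₁]; push_cast; ring
  have hcαℓ : |c' * alpha D * ell D| ≤ |c'| := by
    rw [mul_assoc, abs_mul]
    calc |c'| * |alpha D * ell D| ≤ |c'| * 1 := by
          refine mul_le_mul_of_nonneg_left ?_ (abs_nonneg _)
          rw [abs_of_nonneg (by positivity)]; exact hαℓ
      _ = |c'| := mul_one _
  have hb₁K : |b₁| ≤ K * alpha D := by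
    rw [hb₁, abs_mul, abs_of_pos hα]
    have h1 : |1 - 5 * c' * alpha D * ell D| ≤ 1 + 5 * |c'| := by
      calc |1 - 5 * c' * alpha D * ell D| ≤ |(1 : ℝ)| + |5 * c' * alpha D * ell D| := abs_sub _ _
        _ = 1 + 5 * |c' * alpha D * ell D| := by
            rw [abs_one, show 5 * c' * alpha D * ell D = 5 * (c' * alpha D * ell D) by ring,
              abs_mul, abs_of_pos (by norm_num : (0:ℝ) < 5)]
        _ ≤ 1 + 5 * |c'| := by linarith
    calc alpha D * |1 - 5 * c' * alpha D * ell D| ≤ alpha D * (1 + 5 * |c'|) :=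
          mul_le_mul_of_nonneg_left h1 hα.le
      _ ≤ K * alpha D := by
          rw [hK, show 2 * (1 + 5 * |c'|) * alpha D
              = alpha D * (1 + 5 * |c'|) + alpha D * (1 + 5 * |c'|) by ring]
          have h0 : 0 ≤ alpha D * (1 + 5 * |c'|) := by positivity
          linarith
  -- the relative shift and the functional equation at `s`
  obtain ⟨ε, hL₁, hε⟩ := h D χ hD₁ hq hχ x s hR51 b₁ hb₁K
  set Z : ℂ := GammaFactor.Zfac x.ψ s with hZ
  set u : ℂ := (((x.p : ℝ) * t0 D : ℝ) : ℂ) ^ (-((b₁ : ℂ) * I)) with hu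
  have hZne : Z ≠ 0 := GammaFactor.Zfac_ne_zero x.prim hspos
  have hFE0 : x.ψ.LFunction s = Z * x.ψ⁻¹.LFunction (1 - s) :=
    GammaFactor.LFunction_eq_Zfac_mul x.prim x.p_ne_one hspos.ne'
  set L' : ℂ := x.ψ⁻¹.LFunction (1 - s) with hL'
  set L₁ : ℂ := x.ψ⁻¹.LFunction (1 - s - beta1 c' D) with hL₁def
  have hL₁' : x.ψ.LFunction (s + beta1 c' D) = Z * u * (1 + ε) * L₁ := by
    rw [hβ₁, hL₁, hL₁def, hβ₁]
  have hMu : M = u * (L₁ / L') := by rw [hM, hβ₁]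
  -- the exact identity `L(s+β₁,ψ)/L(s,ψ) = M(1 + ε)`
  have hLHS : x.ψ.LFunction (s + beta1 c' D) / x.ψ.LFunction s = M * (1 + ε) := by
    rw [hL₁', hFE0, hMu, show Z * u * (1 + ε) * L₁ = Z * (u * (1 + ε) * L₁) by ring,
      mul_div_mul_left _ _ hZne]
    ring
  -- `A𝓛⁻¹²³ ≤ (A/π⁶)α⁶`
  have hrate : A * (ell D ^ 123)⁻¹ ≤ A / π ^ 6 * alpha D ^ 6 := by
    have hπ6 : (0 : ℝ) < π ^ 6 := by positivity
    have h54 : (ell D ^ 123)⁻¹ ≤ (ell D ^ 54)⁻¹ := by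
      apply inv_anti₀ (by positivity)
      exact pow_le_pow_right₀ hL1 (by norm_num)
    have hα6 : alpha D ^ 6 = π ^ 6 * (ell D ^ 54)⁻¹ := by
      rw [hαeq, div_pow, ← pow_mul]; norm_num; ring
    rw [hα6, show A / π ^ 6 * (π ^ 6 * (ell D ^ 54)⁻¹) = A * (ell D ^ 54)⁻¹ by field_simp]
    exact mul_le_mul_of_nonneg_left h54 hA0
  rw [hLHS, show M * (1 + ε) - M = M * ε by ring, norm_mul]
  calc ‖M‖ * ‖ε‖ ≤ ‖M‖ * (A / π ^ 6 * alpha D ^ 6) :=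
        mul_le_mul_of_nonneg_left (hε.trans hrate) (norm_nonneg _)
    _ = A / π ^ 6 * alpha D ^ 6 * ‖M‖ := by ring

variable (c' : ℝ) in
/-- `Step17_u010` — `_holds` alias of `step17_u010_holds` above under the fact's exact name, stated under the
prover's own binders as section variables (appended 2026-08-28, D-0026 bookkeeping: the proof term is the
existing theorem of this file; no statement, definition or attribute is edited; no new named fact; the
ledger's debt table listed the fact unproved). [cite: Zhang2022LandauSiegel, §17 p. 97] -/
theorem _root_.Literature.NumberTheory.LFunctions.Zhang2022.Typed.Section17.Step17_u010_holds :
    _root_.Literature.NumberTheory.LFunctions.Zhang2022.Typed.Section17.Step17_u010 c' :=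
  _root_.Literature.NumberTheory.LFunctions.Zhang2022.Typed.Section17.step17_u010_holds (c' := c')

end Typed.Section17

end Literature.NumberTheory.LFunctions.Zhang2022
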